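import Summits.QuantumFields.YangMills.Theorems.ColdBoxAllGroupsBulkAllGroupsDlrPlumbingG
import Summits.QuantumFields.YangMills.Theorems.EntropyBudgetEquipartitionCovTransferPerturb
import HarnessLib

/-!
# Route `EntropyBudgetEquipartition`, crux `EntropyBudgetTransfer` (stmt-QuantumFields-22401) — helper:
# the TWO-SIDED DLR assembly (law of total covariance through a box, with a priced wall term), abstract and in the leaf currency

HONEST LABEL: plumbing toward a RECORD-label rung (R2ξ-G, the all-`G` leaf `WeakCouplingRates.XiPow`, an UPPER bound on the
lattice gap); nothing here bears on the Yang–Mills mass gap.  No analysis and no Lie theory: every one-scale statement is a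
HYPOTHESIS of the theorems below.

## What and why

The crux `EntropyBudgetTransfer` is the two-sided free-gluon law `|β²·Cov_{β,L}(c₀, c_n) − σC(n)²| ≤ Cβ^{−κ'}` for the torus
states, and `Cov_{β,L}(c₀, c_n)` is by definition the leaf currency `WeakCouplingRates.torusPlaqCov r.ρ β L n 1 2`.  The sibling
route `ColdBoxAllGroups` (crux `BulkAllGroups`, stmt-QuantumFields-22255) proved the ONE-SIDED DLR assembly for every compact `G`
(`ColdBoxAllGroups.stub_dlrAssemblyG`, from `torusPlaqCov_eq_boxKernelG`: the torus covariance is `∫q − ∫h·∫k` with `h, k, q` the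
box-kernel means of `c_p, c_q, c_pc_q` at the periodic lift, Georgii 2011 Thm. 4.17), using only `Cov(h,k) ≥ −¼E(h−k)²` for the
covariance of the conditional means.  The two-sided law needs the two-sided version, whose extra input is exactly ONE second
moment — the typical size under the torus state of the coherent background mode `m(ω) = βΣ_c F̄_c(p)²` of the one-scale mean
expansion (`ColdBoxAllGroups.KernelMeanExpansionG`: `βE_ω[c_p] = (D/2)V_D + m(ω) ± β^{−θ}`; `KernelCovExpansionG`:
`β²Cov_ω = (D/2)C_D² + (cross term, |·| ≤ |C_D|(m(ω)+m'(ω))) ± β^{−θ/2}`) — the «typical-boundary budget», which this line's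
entropy pricing (`EntropyBudgetEquipartitionModePricing`, p592160) reduces to a block relative-entropy budget.  This file is the
assembly that consumes it:

* `abs_total_covariance_sub_le` — **abstract two-sided law of total covariance with a good/bad split.**  On a probability space
  with an exceptional event `E` of mass `≤ p`, bounded `h, k` (`≤ K₀`), `q` (`≤ K₀²`), nonnegative modes `m, m' ≤ M` with
  `∫m, ∫m' ≤ τ`, and OFF `E`: `|q − hk − Φ| ≤ ε₁ + C₁(m + m')` (two-sided conditional covariance with cross term) and
  `|h − b₀ − m| ≤ ε`, `|k − b₀' − m'| ≤ ε` (mean expansions, `|b₀|,|b₀'| ≤ B`):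
  `|(∫q − ∫h∫k) − Φ| ≤ ε₁ + 2(C₁ + M)τ + 2ε² + (2K₀² + |Φ| + (K₀ + B)²)·p`
  (mean conditional covariance + the wall term `√E(h−b₀)²·√E(k−b₀')²` of `CovTransfer.abs_cov_mixture_sub_le`, each factor²
  `≤ 2Mτ + 2ε² + (K₀+B)²p`);
* `abs_sq_mul_torusPlaqCov_sub_le` — **the same in the leaf currency, every compact `G`**: for a continuous unitary `ρ`, torus side
  `L+1 > 2(2H+T+2)`, the single-plaquette large-field bound at this `(β, L)` (the body of `PlaquetteLargeFieldRarityG`, LANDED for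
  all `G` as `plaquetteLargeFieldRarityG_allSides`), two-sided kernel bounds at CRUDE-GOOD data in the vocabulary of
  `KernelCovExpansionG` / `KernelMeanExpansionG` (box kernel `boxKernelG ρ β H ω`, centre pair at separation `T`), and the
  typical-boundary budget `∫ m∘torusLift dμ_{L+1,β} ≤ τ`:
  `|β²·torusPlaqCov ρ β L T 1 2 − Φ| ≤ ε₁ + 2(C₁+M)τ + 2ε² + (2(2Nβ)² + |Φ| + (2Nβ+B)²)·6(2H+3)⁴e^{−β^δ}`.

With `Φ = (D/2)C_D(p,q)²` (then `|C_D² − C(T)²| ≲ H^{−4}` by the tree's `exists_boxDirProjKernel_sub_curl_bound`), `ε₁ = β^{−θ/2}`,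
`ε = β^{−θ}`, `C₁ = |C_D| ≤ 1`, `M = Cβ^{2δ}` and `τ` from the entropy pricing, this is the crux at separation `T = ⌈β^A⌉` up to
exponent bookkeeping; the floor never needs `τ`.  Written by width seat 2/3 (gen 3) of line `ym-line-ebe-p1` as
`--supports stmt-QuantumFields-22401`.

References: H.-O. Georgii, *Gibbs Measures and Phase Transitions* (2011) Thm. 4.17 (DLR consistency); R. Durrett, *Probability*
(2019) §4.1 (law of total covariance); the sibling files `ColdBoxAllGroupsBulkAllGroupsDlrPlumbingG` /
`…StubDlrAssemblyG` (one-sided template). [folklore]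
-/

set_option autoImplicit false

noncomputable section

open MeasureTheory Filter Topology
open Literature.MathematicalPhysics
open Literature.MathematicalPhysics.QuantumFieldTheory
open Literature.MathematicalPhysics.QuantumLattice
open Summit.QuantumFields.YangMills.Theorems.WeakCouplingRates
open Summit.QuantumFields.YangMills.Theorems.ColdBoxAllGroups

namespace Summit.QuantumFields.YangMills.Theorems.EntropyBudgetEquipartition.TwoSidedDlr

/-! ### §1 The abstract two-sided law of total covariance with a good/bad split and a priced wall term -/

/-- **Two-sided law of total covariance with an exceptional event.**  Let `h, k, q` be bounded measurable (`|h|,|k| ≤ K₀`,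
`|q| ≤ K₀²`), `m, m'` measurable modes with `0 ≤ m, m' ≤ M` and `∫m, ∫m' ≤ τ`, `E` an event of mass `≤ p`, and suppose that OFF
`E` the conditional covariance is two-sided close to `Φ` up to the cross term, `|q − hk − Φ| ≤ ε₁ + C₁(m + m')`, and the conditional
means expand as `|h − b₀ − m| ≤ ε`, `|k − b₀' − m'| ≤ ε` with `|b₀|, |b₀'| ≤ B`.  Then
`|(∫q − ∫h·∫k) − Φ| ≤ ε₁ + 2(C₁ + M)τ + 2ε² + (2K₀² + |Φ| + (K₀ + B)²)·p`.
(Mean conditional covariance: pointwise bound integrated; wall term: `CovTransfer.abs_cov_mixture_sub_le` and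
`(h − b₀)² ≤ 2Mm + 2ε²` off `E`.) [folklore] -/
theorem abs_total_covariance_sub_le {Ω : Type*} [MeasurableSpace Ω] {μ : Measure Ω} [IsProbabilityMeasure μ]
    {E : Set Ω} (hE : MeasurableSet E) {h k q m m' : Ω → ℝ}
    (hhm : Measurable h) (hkm : Measurable k) (hqm : Measurable q) (hmm : Measurable m) (hm'm : Measurable m')
    {K₀ Φ b₀ b₀' B ε ε₁ C₁ M τ p : ℝ}
    (hhK : ∀ ω, |h ω| ≤ K₀) (hkK : ∀ ω, |k ω| ≤ K₀) (hqK : ∀ ω, |q ω| ≤ K₀ ^ 2)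
    (hm0 : ∀ ω, 0 ≤ m ω) (hmM : ∀ ω, m ω ≤ M) (hm0' : ∀ ω, 0 ≤ m' ω) (hmM' : ∀ ω, m' ω ≤ M)
    (hb₀ : |b₀| ≤ B) (hb₀' : |b₀'| ≤ B) (hε₁ : 0 ≤ ε₁) (hC₁ : 0 ≤ C₁)
    (hcov : ∀ ω, ω ∉ E → |q ω - h ω * k ω - Φ| ≤ ε₁ + C₁ * (m ω + m' ω))
    (hmean : ∀ ω, ω ∉ E → |h ω - b₀ - m ω| ≤ ε) (hmean' : ∀ ω, ω ∉ E → |k ω - b₀' - m' ω| ≤ ε)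
    (hτ : ∫ ω, m ω ∂μ ≤ τ) (hτ' : ∫ ω, m' ω ∂μ ≤ τ) (hμE : μ.real E ≤ p) :
    |(∫ ω, q ω ∂μ) - (∫ ω, h ω ∂μ) * (∫ ω, k ω ∂μ) - Φ| ≤
      ε₁ + 2 * (C₁ + M) * τ + 2 * ε ^ 2 + (2 * K₀ ^ 2 + |Φ| + (K₀ + B) ^ 2) * p := by
  obtain ⟨ω₁⟩ := nonempty_of_isProbabilityMeasure μ
  have hK : 0 ≤ K₀ := (abs_nonneg _).trans (hhK ω₁)
  have hM : 0 ≤ M := (hm0 ω₁).trans (hmM ω₁)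
  have hB : 0 ≤ B := (abs_nonneg _).trans hb₀
  have hE0 : 0 ≤ μ.real E := measureReal_nonneg
  have hp : 0 ≤ p := hE0.trans hμE
  have bdd : ∀ {f : Ω → ℝ} (C : ℝ), Measurable f → (∀ ω, |f ω| ≤ C) → Integrable f μ := fun C hf hC =>
    Integrable.of_bound hf.aestronglyMeasurable C (ae_of_all _ fun ω => by simpa [Real.norm_eq_abs] using hC ω)
  have hmK : ∀ ω, |m ω| ≤ M := fun ω => by rw [abs_of_nonneg (hm0 ω)]; exact hmM ω
  have hmK' : ∀ ω, |m' ω| ≤ M := fun ω => by rw [abs_of_nonneg (hm0' ω)]; exact hmM' ω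
  have hhkb : ∀ ω, |h ω * k ω| ≤ K₀ ^ 2 := fun ω => by
    rw [abs_mul, sq]; exact mul_le_mul (hhK ω) (hkK ω) (abs_nonneg _) hK
  have hhi : Integrable h μ := bdd K₀ hhm hhK
  have hki : Integrable k μ := bdd K₀ hkm hkK
  have hqi : Integrable q μ := bdd _ hqm hqK
  have hmi : Integrable m μ := bdd M hmm hmK
  have hmi' : Integrable m' μ := bdd M hm'm hmK'
  have hhki : Integrable (fun ω => h ω * k ω) μ := bdd _ (hhm.mul hkm) hhkb
  have hind : Integrable (E.indicator fun _ => (1 : ℝ)) μ := (integrable_const _).indicator hE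
  have hindE : ∫ ω, E.indicator (fun _ => (1 : ℝ)) ω ∂μ = μ.real E := by
    rw [integral_indicator_const _ hE]; simp
  have hind0 : ∀ ω, 0 ≤ E.indicator (fun _ => (1 : ℝ)) ω := fun ω => Set.indicator_nonneg (fun _ _ => zero_le_one) ω
  -- Step 1: the mean of the conditional covariances is within `ε₁ + 2C₁τ + (2K₀² + |Φ|)p` of `Φ`
  set cE : ℝ := 2 * K₀ ^ 2 + |Φ| with hcE
  have hcE0 : 0 ≤ cE := by positivity
  have hstep1 : |(∫ ω, (q ω - h ω * k ω) ∂μ) - Φ| ≤ ε₁ + 2 * C₁ * τ + cE * p := by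
    have i1 : Integrable (fun ω => q ω - h ω * k ω) μ := by exact hqi.sub hhki
    have hfi : Integrable (fun ω => q ω - h ω * k ω - Φ) μ := by exact i1.sub (integrable_const _)
    have e1 : (∫ ω, (q ω - h ω * k ω) ∂μ) - Φ = ∫ ω, (q ω - h ω * k ω - Φ) ∂μ := by
      rw [integral_sub i1 (integrable_const Φ), integral_const, probReal_univ, one_smul]
    rw [e1]
    have hpt : ∀ ω, |q ω - h ω * k ω - Φ| ≤
        ε₁ + C₁ * (m ω + m' ω) + cE * E.indicator (fun _ => (1 : ℝ)) ω := by
      intro ω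
      by_cases hω : ω ∈ E
      · rw [Set.indicator_of_mem hω, mul_one]
        have h1 : |q ω - h ω * k ω - Φ| ≤ |q ω| + |h ω * k ω| + |Φ| := by
          have := abs_sub (q ω - h ω * k ω) Φ
          have := abs_sub (q ω) (h ω * k ω)
          linarith
        have h2 : 0 ≤ C₁ * (m ω + m' ω) := mul_nonneg hC₁ (add_nonneg (hm0 ω) (hm0' ω))
        rw [hcE]
        linarith [hqK ω, hhkb ω]
      · rw [Set.indicator_of_notMem hω, mul_zero, add_zero]
        exact hcov ω hω
    have iM : Integrable (fun ω => m ω + m' ω) μ := by exact hmi.add hmi'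
    have iCM : Integrable (fun ω => C₁ * (m ω + m' ω)) μ := by exact iM.const_mul C₁
    have iA : Integrable (fun ω => ε₁ + C₁ * (m ω + m' ω)) μ := by exact (integrable_const ε₁).add iCM
    have iI : Integrable (fun ω => cE * E.indicator (fun _ => (1 : ℝ)) ω) μ := by exact hind.const_mul cE
    have hgi : Integrable (fun ω => ε₁ + C₁ * (m ω + m' ω) + cE * E.indicator (fun _ => (1 : ℝ)) ω) μ := by
      exact iA.add iI
    calc |∫ ω, (q ω - h ω * k ω - Φ) ∂μ| ≤ ∫ ω, |q ω - h ω * k ω - Φ| ∂μ := abs_integral_le_integral_abs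
      _ ≤ ∫ ω, (ε₁ + C₁ * (m ω + m' ω) + cE * E.indicator (fun _ => (1 : ℝ)) ω) ∂μ :=
          integral_mono hfi.abs hgi hpt
      _ = ε₁ + C₁ * ((∫ ω, m ω ∂μ) + ∫ ω, m' ω ∂μ) + cE * μ.real E := by
          rw [integral_add iA iI, integral_add (integrable_const ε₁) iCM, integral_const_mul, integral_const_mul,
            integral_add hmi hmi', integral_const, probReal_univ, one_smul, hindE]
      _ ≤ ε₁ + 2 * C₁ * τ + cE * p := by
          have h1 : C₁ * ((∫ ω, m ω ∂μ) + ∫ ω, m' ω ∂μ) ≤ C₁ * (τ + τ) :=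
            mul_le_mul_of_nonneg_left (add_le_add hτ hτ') hC₁
          have h2 : cE * μ.real E ≤ cE * p := mul_le_mul_of_nonneg_left hμE hcE0
          linarith
  -- Step 2: the wall term — each conditional mean fluctuates by at most `W` in mean square
  set W : ℝ := 2 * M * τ + 2 * ε ^ 2 + (K₀ + B) ^ 2 * p with hW
  have hfluct : ∀ {g n : Ω → ℝ} {g₀ : ℝ}, Measurable g → Measurable n → (∀ ω, |g ω| ≤ K₀) → (∀ ω, 0 ≤ n ω) →
      (∀ ω, n ω ≤ M) → |g₀| ≤ B → (∀ ω, ω ∉ E → |g ω - g₀ - n ω| ≤ ε) → (∫ ω, n ω ∂μ ≤ τ) →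
      ∫ ω, (g ω - g₀) ^ 2 ∂μ ≤ W := by
    intro g n g₀ hgm hnm hgK hn0 hnM hg₀ hexp hnτ
    have hni : Integrable n μ := bdd M hnm fun ω => by rw [abs_of_nonneg (hn0 ω)]; exact hnM ω
    have hpt : ∀ ω, (g ω - g₀) ^ 2 ≤ 2 * M * n ω + 2 * ε ^ 2 + (K₀ + B) ^ 2 * E.indicator (fun _ => (1 : ℝ)) ω := by
      intro ω
      by_cases hω : ω ∈ E
      · rw [Set.indicator_of_mem hω, mul_one]
        have h1 : |g ω - g₀| ≤ K₀ + B := (abs_sub _ _).trans (add_le_add (hgK ω) hg₀)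
        have h2 : (g ω - g₀) ^ 2 ≤ (K₀ + B) ^ 2 := by
          rw [← sq_abs]; exact pow_le_pow_left₀ (abs_nonneg _) h1 2
        nlinarith [hn0 ω, sq_nonneg ε]
      · rw [Set.indicator_of_notMem hω, mul_zero, add_zero]
        have hr := hexp ω hω
        set r : ℝ := g ω - g₀ - n ω with hr'
        have e : g ω - g₀ = n ω + r := by rw [hr']; ring
        rw [e]
        have h1 : (n ω + r) ^ 2 ≤ 2 * n ω ^ 2 + 2 * r ^ 2 := by nlinarith [sq_nonneg (n ω - r)]
        have h2 : n ω ^ 2 ≤ M * n ω := by nlinarith [hn0 ω, hnM ω]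
        have h3 : r ^ 2 ≤ ε ^ 2 := by
          rw [← sq_abs]; exact pow_le_pow_left₀ (abs_nonneg _) hr 2
        linarith
    have iN : Integrable (fun ω => 2 * M * n ω) μ := by exact hni.const_mul (2 * M)
    have iA : Integrable (fun ω => 2 * M * n ω + 2 * ε ^ 2) μ := by exact iN.add (integrable_const _)
    have iI : Integrable (fun ω => (K₀ + B) ^ 2 * E.indicator (fun _ => (1 : ℝ)) ω) μ := by
      exact hind.const_mul _
    have hgi : Integrable (fun ω => 2 * M * n ω + 2 * ε ^ 2 + (K₀ + B) ^ 2 * E.indicator (fun _ => (1 : ℝ)) ω) μ := by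
      exact iA.add iI
    calc ∫ ω, (g ω - g₀) ^ 2 ∂μ
        ≤ ∫ ω, (2 * M * n ω + 2 * ε ^ 2 + (K₀ + B) ^ 2 * E.indicator (fun _ => (1 : ℝ)) ω) ∂μ :=
          integral_mono_of_nonneg (ae_of_all _ fun ω => sq_nonneg _) hgi (ae_of_all _ hpt)
      _ = 2 * M * (∫ ω, n ω ∂μ) + 2 * ε ^ 2 + (K₀ + B) ^ 2 * μ.real E := by
          rw [integral_add iA iI, integral_add iN (integrable_const _), integral_const_mul, integral_const,
            integral_const_mul, probReal_univ, one_smul, hindE]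
      _ ≤ W := by
          have h1 : 2 * M * (∫ ω, n ω ∂μ) ≤ 2 * M * τ := mul_le_mul_of_nonneg_left hnτ (by positivity)
          have h2 : (K₀ + B) ^ 2 * μ.real E ≤ (K₀ + B) ^ 2 * p := mul_le_mul_of_nonneg_left hμE (sq_nonneg _)
          rw [hW]; linarith
  have hWh : ∫ ω, (h ω - b₀) ^ 2 ∂μ ≤ W := hfluct hhm hmm hhK hm0 hmM hb₀ hmean hτ
  have hWk : ∫ ω, (k ω - b₀') ^ 2 ∂μ ≤ W := hfluct hkm hm'm hkK hm0' hmM' hb₀' hmean' hτ'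
  have hW0 : 0 ≤ W := (integral_nonneg fun ω => sq_nonneg _).trans hWh
  have hhL2 : MemLp h 2 μ :=
    MemLp.of_bound hhm.aestronglyMeasurable K₀ (ae_of_all _ fun ω => by simpa [Real.norm_eq_abs] using hhK ω)
  have hkL2 : MemLp k 2 μ :=
    MemLp.of_bound hkm.aestronglyMeasurable K₀ (ae_of_all _ fun ω => by simpa [Real.norm_eq_abs] using hkK ω)
  have hwall : |((∫ ω, q ω ∂μ) - (∫ ω, h ω ∂μ) * (∫ ω, k ω ∂μ)) - ∫ ω, (q ω - h ω * k ω) ∂μ| ≤ W := by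
    have key := CovTransfer.abs_cov_mixture_sub_le (μ := μ) (a := q) (b := h) (c := k) hqi hhL2 hkL2 rfl rfl rfl b₀ b₀'
    refine key.trans ?_
    calc Real.sqrt (∫ ω, (h ω - b₀) ^ 2 ∂μ) * Real.sqrt (∫ ω, (k ω - b₀') ^ 2 ∂μ)
        ≤ Real.sqrt W * Real.sqrt W :=
          mul_le_mul (Real.sqrt_le_sqrt hWh) (Real.sqrt_le_sqrt hWk) (Real.sqrt_nonneg _) (Real.sqrt_nonneg _)
      _ = W := Real.mul_self_sqrt hW0
  -- Step 3: triangle inequality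
  have htri : |(∫ ω, q ω ∂μ) - (∫ ω, h ω ∂μ) * (∫ ω, k ω ∂μ) - Φ| ≤
      |((∫ ω, q ω ∂μ) - (∫ ω, h ω ∂μ) * (∫ ω, k ω ∂μ)) - ∫ ω, (q ω - h ω * k ω) ∂μ| +
        |(∫ ω, (q ω - h ω * k ω) ∂μ) - Φ| := by
    have := abs_sub_le ((∫ ω, q ω ∂μ) - (∫ ω, h ω ∂μ) * (∫ ω, k ω ∂μ)) (∫ ω, (q ω - h ω * k ω) ∂μ) Φ
    simpa only [sub_sub] using this
  calc |(∫ ω, q ω ∂μ) - (∫ ω, h ω ∂μ) * (∫ ω, k ω ∂μ) - Φ|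
      ≤ W + (ε₁ + 2 * C₁ * τ + cE * p) := htri.trans (add_le_add hwall hstep1)
    _ = ε₁ + 2 * (C₁ + M) * τ + 2 * ε ^ 2 + (2 * K₀ ^ 2 + |Φ| + (K₀ + B) ^ 2) * p := by
        rw [hW, hcE]; ring

/-! ### §2 The leaf currency: the torus two-point function of every compact `G`, two-sided -/

section Leaf

variable {N : ℕ} {G : Type*} [Group G] [TopologicalSpace G] [IsTopologicalGroup G] [CompactSpace G]
  [MeasurableSpace G] [BorelSpace G]

/-- **Two-sided DLR assembly in the leaf currency, every compact `G`.**  Let `ρ` be a continuous unitary representation, `β ≥ 0`,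
a box of half-side `H`, a separation `T`, a torus of side `L+1 > 2(2H+T+2)`, and suppose: (rarity) every single-plaquette
large-field indicator `𝟙{β^{2δ−1} ≤ c}` has torus expectation `≤ e^{−β^δ}` at this `(β, L)`; (modes) `m, m'` measurable functions
of the datum with `0 ≤ m, m' ≤ M` and typical-boundary budget `∫ m∘torusLift dμ_{L+1,β}, ∫ m'∘torusLift dμ_{L+1,β} ≤ τ`; (kernel,
two-sided, at CRUDE-GOOD data `ω`) `|β²·Cov_ω(c_p, c_q) − Φ| ≤ ε₁ + C₁(m(ω) + m'(ω))` and `|βE_ω[c_p] − b₀ − m(ω)| ≤ ε`,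
`|βE_ω[c_q] − b₀' − m'(ω)| ≤ ε` for the box kernel `boxKernelG ρ β H ω`, `p = (boxCentre H; 1,2)`, `q = p + Te₀`, `|b₀|,|b₀'| ≤ B`.
Then `|β²·torusPlaqCov ρ β L T 1 2 − Φ| ≤ ε₁ + 2(C₁+M)τ + 2ε² + (2(2Nβ)² + |Φ| + (2Nβ+B)²)·6(2H+3)⁴e^{−β^δ}`.
(`torusPlaqCov_eq_boxKernelG` + `abs_total_covariance_sub_le` with the bad set of `measureReal_badSetG_le`, `K₀ = 2Nβ`.)
[cite: Georgii2011, Thm. 4.17] -/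
theorem abs_sq_mul_torusPlaqCov_sub_le [SecondCountableTopology G] (ρ : G →* Matrix (Fin N) (Fin N) ℂ)
    (hρ : Continuous ρ) (hρu : ∀ g, ρ g ∈ Matrix.unitaryGroup (Fin N) ℂ)
    {β δ : ℝ} (hβ : 0 ≤ β) {H T L : ℕ} (hL : 2 * (2 * H + T + 2) < L + 1)
    (hL2 : ∀ (x : Literature.Probability.LatticeModels.Site 4) (i j : Fin 4), i < j →
      wilsonExpectation (L := L + 1) ρ β
          (toTorusObservable (L + 1) fun U : LGConfig 4 G =>
            if β ^ (2 * δ - 1) ≤ plaqCostAt ρ x i j U then (1 : ℝ) else 0) ≤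
        Real.exp (-(β ^ δ)))
    {m m' : LGConfig 4 G → ℝ} (hmm : Measurable m) (hm'm : Measurable m')
    {M Φ b₀ b₀' B ε ε₁ C₁ τ : ℝ}
    (hm0 : ∀ ω, 0 ≤ m ω) (hmM : ∀ ω, m ω ≤ M) (hm0' : ∀ ω, 0 ≤ m' ω) (hmM' : ∀ ω, m' ω ≤ M)
    (hb₀ : |b₀| ≤ B) (hb₀' : |b₀'| ≤ B) (hε₁ : 0 ≤ ε₁) (hC₁ : 0 ≤ C₁)
    (hcov : ∀ ω : LGConfig 4 G, CrudeGoodG ρ β δ H ω →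
      |β ^ 2 * ((∫ U, plaqCostAt ρ (boxCentre H) 1 2 U * plaqCostAt ρ (boxCentre H + Pi.single 0 (T : ℤ)) 1 2 U
              ∂(boxKernelG ρ β H ω)) -
            (∫ U, plaqCostAt ρ (boxCentre H) 1 2 U ∂(boxKernelG ρ β H ω)) *
              (∫ U, plaqCostAt ρ (boxCentre H + Pi.single 0 (T : ℤ)) 1 2 U ∂(boxKernelG ρ β H ω))) - Φ|
        ≤ ε₁ + C₁ * (m ω + m' ω))
    (hmean : ∀ ω : LGConfig 4 G, CrudeGoodG ρ β δ H ω →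
      |β * (∫ U, plaqCostAt ρ (boxCentre H) 1 2 U ∂(boxKernelG ρ β H ω)) - b₀ - m ω| ≤ ε)
    (hmean' : ∀ ω : LGConfig 4 G, CrudeGoodG ρ β δ H ω →
      |β * (∫ U, plaqCostAt ρ (boxCentre H + Pi.single 0 (T : ℤ)) 1 2 U ∂(boxKernelG ρ β H ω)) - b₀' - m' ω| ≤ ε)
    (hτ : ∫ U, m (torusLift (L + 1) U) ∂(wilsonMeasure (d := 4) (L := L + 1) ρ β) ≤ τ)
    (hτ' : ∫ U, m' (torusLift (L + 1) U) ∂(wilsonMeasure (d := 4) (L := L + 1) ρ β) ≤ τ) :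
    |β ^ 2 * torusPlaqCov (d := 4) ρ β L T 1 2 - Φ| ≤
      ε₁ + 2 * (C₁ + M) * τ + 2 * ε ^ 2 +
        (2 * (2 * (N : ℝ) * β) ^ 2 + |Φ| + (2 * (N : ℝ) * β + B) ^ 2) *
          (((6 * (2 * H + 3) ^ 4 : ℕ) : ℝ) * Real.exp (-(β ^ δ))) := by
  haveI := isProbabilityMeasure_wilsonMeasure (d := 4) (L := L + 1) (G := G) ρ hρ β
  set μ := wilsonMeasure (d := 4) (L := L + 1) ρ β with hμ
  set Nr : ℝ := (N : ℝ) with hNr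
  have hNr : 0 ≤ Nr := Nat.cast_nonneg _
  -- the kernel quantities at the periodic lift
  set Λ : Finset (QuantumLattice.ZdEdge 4) := AxialGauge.boxEdges 4 (2 * H + 1) with hΛ
  set bc : Literature.Probability.LatticeModels.Site 4 := boxCentre H with hbc
  set v0 : Literature.Probability.LatticeModels.Site 4 := Pi.single 0 (T : ℤ) with hv0
  set cp : LGConfig 4 G → ℝ := plaqCostAt ρ bc 1 2 with hcp
  set cp' : LGConfig 4 G → ℝ := plaqCostAt ρ (bc + v0) 1 2 with hcp'
  set h₀ : GaugeConfig 4 (L + 1) G → ℝ := fun U => ∫ W, cp W ∂(ymSpecification ρ β Λ (torusLift (L + 1) U)) with hh₀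
  set k₀ : GaugeConfig 4 (L + 1) G → ℝ := fun U => ∫ W, cp' W ∂(ymSpecification ρ β Λ (torusLift (L + 1) U)) with hk₀
  set q₀ : GaugeConfig 4 (L + 1) G → ℝ :=
    fun U => ∫ W, cp W * cp' W ∂(ymSpecification ρ β Λ (torusLift (L + 1) U)) with hq₀
  have hcpc : Continuous cp := continuous_plaqCostAtG ρ hρ bc 1 2
  have hcpc' : Continuous cp' := continuous_plaqCostAtG ρ hρ (bc + v0) 1 2
  have hcpK : ∀ U, |cp U| ≤ 2 * Nr := abs_plaqCostAt_leG ρ hρu bc 1 2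
  have hcpK' : ∀ U, |cp' U| ≤ 2 * Nr := abs_plaqCostAt_leG ρ hρu (bc + v0) 1 2
  have hqc : Continuous fun U => cp U * cp' U := hcpc.mul hcpc'
  have hqK : ∀ U, |cp U * cp' U| ≤ (2 * Nr) ^ 2 := abs_plaqCostAt_mul_leG ρ hρu bc (bc + v0) 1 2
  have hml := measurable_torusLift (d := 4) (G := G) (L + 1)
  have hh₀m : Measurable h₀ := (continuous_integral_ymSpecification ρ hρ β Λ hcpc hcpK).measurable.comp hml
  have hk₀m : Measurable k₀ := (continuous_integral_ymSpecification ρ hρ β Λ hcpc' hcpK').measurable.comp hml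
  have hq₀m : Measurable q₀ := (continuous_integral_ymSpecification ρ hρ β Λ hqc hqK).measurable.comp hml
  have hh₀K : ∀ U, |h₀ U| ≤ 2 * Nr := fun U => abs_integral_ymSpecification_le ρ hρ β Λ hcpK _
  have hk₀K : ∀ U, |k₀ U| ≤ 2 * Nr := fun U => abs_integral_ymSpecification_le ρ hρ β Λ hcpK' _
  have hq₀K : ∀ U, |q₀ U| ≤ (2 * Nr) ^ 2 := fun U => abs_integral_ymSpecification_le ρ hρ β Λ hqK _
  -- the β-scaled quantities fed to the abstract assembly
  set h : GaugeConfig 4 (L + 1) G → ℝ := fun U => β * h₀ U with hh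
  set k : GaugeConfig 4 (L + 1) G → ℝ := fun U => β * k₀ U with hk
  set q : GaugeConfig 4 (L + 1) G → ℝ := fun U => β ^ 2 * q₀ U with hq
  set mt : GaugeConfig 4 (L + 1) G → ℝ := fun U => m (torusLift (L + 1) U) with hmt
  set mt' : GaugeConfig 4 (L + 1) G → ℝ := fun U => m' (torusLift (L + 1) U) with hmt'
  have hhm : Measurable h := hh₀m.const_mul β
  have hkm : Measurable k := hk₀m.const_mul β
  have hqm : Measurable q := hq₀m.const_mul (β ^ 2)
  have hmtm : Measurable mt := hmm.comp hml
  have hmt'm : Measurable mt' := hm'm.comp hml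
  have hhK : ∀ U, |h U| ≤ 2 * Nr * β := fun U => by
    calc |h U| = β * |h₀ U| := by rw [hh]; dsimp only; rw [abs_mul, abs_of_nonneg hβ]
      _ ≤ β * (2 * Nr) := mul_le_mul_of_nonneg_left (hh₀K U) hβ
      _ = 2 * Nr * β := by ring
  have hkK : ∀ U, |k U| ≤ 2 * Nr * β := fun U => by
    calc |k U| = β * |k₀ U| := by rw [hk]; dsimp only; rw [abs_mul, abs_of_nonneg hβ]
      _ ≤ β * (2 * Nr) := mul_le_mul_of_nonneg_left (hk₀K U) hβ
      _ = 2 * Nr * β := by ring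
  have hqK' : ∀ U, |q U| ≤ (2 * Nr * β) ^ 2 := fun U => by
    calc |q U| = β ^ 2 * |q₀ U| := by rw [hq]; dsimp only; rw [abs_mul, abs_of_nonneg (sq_nonneg β)]
      _ ≤ β ^ 2 * (2 * Nr) ^ 2 := mul_le_mul_of_nonneg_left (hq₀K U) (sq_nonneg β)
      _ = (2 * Nr * β) ^ 2 := by ring
  -- the bad event and its mass
  set E : Set (GaugeConfig 4 (L + 1) G) := {U | torusLift (L + 1) U ∈
      ⋃ z ∈ (Fintype.piFinset fun _ : Fin 4 => Finset.Icc (-1 : ℤ) (2 * (H : ℤ) + 1)) ×ˢ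
          ((Finset.univ : Finset (Fin 4 × Fin 4)).filter fun q => q.1 < q.2),
        {W : LGConfig 4 G | β ^ (2 * δ - 1) < plaqCostAt ρ z.1 z.2.1 z.2.2 W}} with hE
  have hEm : MeasurableSet E := hml (measurableSet_badSetG ρ hρ β δ H)
  have hgood : ∀ U, U ∉ E → CrudeGoodG ρ β δ H (torusLift (L + 1) U) := fun U hU => crudeGoodG_of_not_mem_badSet ρ hU
  set p : ℝ := ((6 * (2 * H + 3) ^ 4 : ℕ) : ℝ) * Real.exp (-(β ^ δ)) with hp
  have hμE : μ.real E ≤ p := measureReal_badSetG_le ρ hρ hL2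
  -- the kernel hypotheses, transported to the torus configurations off the bad event
  have hcov' : ∀ U, U ∉ E → |q U - h U * k U - Φ| ≤ ε₁ + C₁ * (mt U + mt' U) := by
    intro U hU
    have e1 : q U - h U * k U - Φ = β ^ 2 * (q₀ U - h₀ U * k₀ U) - Φ := by
      rw [hq, hh, hk]; dsimp only; ring
    rw [e1]
    exact hcov _ (hgood U hU)
  have hmean₁ : ∀ U, U ∉ E → |h U - b₀ - mt U| ≤ ε := fun U hU => hmean _ (hgood U hU)
  have hmean₂ : ∀ U, U ∉ E → |k U - b₀' - mt' U| ≤ ε := fun U hU => hmean' _ (hgood U hU)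
  have hτ₁ : ∫ U, mt U ∂μ ≤ τ := hτ
  have hτ₂ : ∫ U, mt' U ∂μ ≤ τ := hτ'
  -- the torus covariance through the kernels, β-scaled
  have hrepr : β ^ 2 * torusPlaqCov (d := 4) ρ β L T 1 2 - Φ =
      (∫ U, q U ∂μ) - (∫ U, h U ∂μ) * (∫ U, k U ∂μ) - Φ := by
    rw [torusPlaqCov_eq_boxKernelG ρ hρ hρu β hL, hq, hh, hk]
    dsimp only
    rw [integral_const_mul, integral_const_mul, integral_const_mul]
    ring
  rw [hrepr]
  have main := abs_total_covariance_sub_le (μ := μ) hEm hhm hkm hqm hmtm hmt'm (K₀ := 2 * Nr * β) (Φ := Φ)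
    hhK hkK hqK' (fun U => hm0 _) (fun U => hmM _) (fun U => hm0' _) (fun U => hmM' _) hb₀ hb₀' hε₁ hC₁
    hcov' hmean₁ hmean₂ hτ₁ hτ₂ hμE
  simpa only [hNr] using main

end Leaf

end Summit.QuantumFields.YangMills.Theorems.EntropyBudgetEquipartition.TwoSidedDlr

end
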